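import Summits.QuantumFields.YangMills.Theorems.BalabanUVNodesN05SubBP2DSlotExistsOfThm33JunctionHAtZdFrame
import Summits.QuantumFields.YangMills.Theorems.BalabanUVNodesN05AtXPinnedP2DSViewSepCoPH

/-!
# BalabanUVNodes ∕ N05 ([B8], `Dag.B8_main`) AT THE K1 ENGINE'S FOUR-PIN X-P₂D VIEW — PRINT'S BACKGROUND (v1.7 key `SepCoPH`), «P₂D» PIN, SC-BINDING: N05 IN ∃-CURRENCY AT THE
# RECORD `Node00.IsRecordOfRecord₁₃CSepCoPHSX3P₂DV` — FROM [4] THM 3.1's LETTERS, N06's THEOREM 3.3 AT ITS FULL `ℤᵈ` FRAME OF RECORD (`geoZd ∕ bgZd ∕ GAZdFamOfOps ∕ ιLocZd`, letters `withQQP ∘ withDpZd`) AND SIX JUNCTION BINDERS — `havg`, `hP6`, `hdict`, `hcurv` DISCHARGED — the X-view record image of dag-n05-d g14's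
# `BalabanUVNodesN05SubBP2DSlotExistsOfThm33JunctionHAtZdFrame.exists_residB8_b8LeafOfRecordSubBP₂D_cutSubBP₅_of_letters_thm33_junctionH_zdFrame`
# through this seat's X-view slot closer (p622349; sibling of the one-pin CoPH images in `BalabanUVNodesN05AtRecord13SubBP2DSepCoPHOfThm33JunctionHAtZdFrame`)

Track A of `YM-PLAN.md` (cell `pub-ymgap`, HUMAN RULING D-0062 ∕ D-0149 width seats), node **N05** = [Balaban1985RegularSpaces], in-edge **N06** = [Balaban1985BackgroundPropagators];
width seat `pub-ymgap-dag-n05-w4` (g3), 2026-08-28, key item K1⁹ `StabilityBRunRowsAtRecordR13SepCoPHV` (dag-lead KEY MAP v2; `--supports`, helper; count-neutral).  Standing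
split of the N05 lanes (cell bus 09:37Z ∕ 10:46Z ∕ 11:36Z ∕ 11:58Z): slot-level editions and their Sep-keyed record images = dag-n05-d ∕ dag-n05-e; CoPH ∕ G ∕ X-view images = this seat.

THE EDITION READ HERE (dag-n05-d g14): dag-n05-d g14's `…AtZdFrame` (CLAIM-1 ∕ FILED-1 p633678, cell bus 2026-08-28 12:04Z ∕ 12:27Z): dag-n05-e's `_P6` edition with `(geo, GA, ιLoc) := (geoZd θ.𝔸 θ.L len, GAZdFamOfOps θ.𝔸 θ.L len ops, ιLocZd θ.𝔸 θ.L len)` and the letter pin `hops : ops M i m = withQQP τ θ.L (towerBondsP-class of i) (withDpZd ops₀) M i m`; `hdict` discharged by n06-e's `dictAt_of_global (dictGlob_zd …)`, `hcurv` by n06-w2's `curvAtInAk_of_Dp_eq` ((3.69), `c69 := 14(D−1)`); N06's sentence read VERBATIM as `B9.Thm33Printed c35 (geoZd …) (bgZd …) Gp (GAZdFamOfOps … ops)`; SIX junction binders remain (`InvAtH ∕ LandauAt ∕ HolderAtδ2 ∕ LinBddAt ∕ SrcAt ∕ SrcHolderAtδ2`).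

* ★ `exists_isRecordOfRecord₁₃CSepCoPHSX3P₂DV_b8_of_letters_thm33_junctionH_zdFrame` — for `θ : Stage13HParams F N` with `Provisos₁₃SepCoPH`, `Admissible`, `5 ≤ L`, ANY `lam12 lam13 Mstar ops13 ζ lamW`
  ([B12] ∕ [B13] groups, B10 ∕ Y ∕ Z ∕ W pins), window `0 < γw ≤ θ.γ`: the supplier's two numbers, then its curried hypotheses VERBATIM over `θ.toStage3Params` ⊢ `∃ lam c₁ ρ₀ w w′` — the
  engine-shaped record bound by `upOfRecord₅CSC` over `(θ.pinX3P₂D (lam.cutSubBP₅ c₁ ρ₀) lam12 lam13).view₁₃CoPHB10YZW Mstar ops13 ζ lamW`, `w.C ∕ w.γ = γw ∕ w.L`, every run's `b8` leaf and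
  `Dag.B8_main`, and the `₁₃CSepCoPH` companion (G-class membership by `Node00.isRecordOfRecord₁₃CSepCoPHG_of_isRecordOfRecord₁₃CSepCoPHSX3P₂DV`, p621198).
* §2 ★ `…SX3P₂DV_b8_of_letters_thm33_junctionH_zdFrameI` — the X-view image of the INDEX-GENERIC edition `_zdFrameI` (dag-n05-d g14 v1.1 p636957 §2: any index `I`,
  `π : I → MemberZd`, `hmem` at the admissible members).
HONEST FRAMING: kernel bookkeeping by name (`obtain` ∕ `refine` ∕ `intro` ∕ `obtain` ∕ `exact`); NO estimate; nothing of [Balaban1985RegularSpaces] ∕ [Balaban1985BackgroundPropagators]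
asserted — [4] Thm 3.1's letters `SLet ∕ SLetUB`, N06's `B9.Thm33Printed` at its `ℤᵈ` frame (N06's node sentence (γ), unproved here) and the six remaining junction binders are HYPOTHESES (N06 content, m ≥ 1 OPEN; satisfiability class-wise NOT claimed); Prop 6, the dictionary and (3.69) are THEOREMS inside; `5 ≤ L` a guard; Proposition 7 inside the slot in the repaired currency `c₇OfRecord θ₃` (WATCH-P7-CURRENCY-RECORD);
count-neutral; **N05 NOT discharged**; K1 NOT claimed; no count claim; Bałaban AS PRINTED with locators; one finite 𝕋⁴ programme at fixed ε — the Yang–Mills mass gap (Clay) is NOT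
proved by any of this; R4 closes the conditional finite-𝕋⁴ rung `BalabanLadder.UV` only; nothing continuum ∕ ℝ⁴ ∕ OS.  No `sorry`, no new definition, no `instance`, no `notation`.
Unit `pub-ymgap-dag-n05-w4` (g3), 2026-08-28.
[cite: Balaban1985RegularSpaces, Lemma 1 – Thm 8 pp.79–101, Prop. 6 p.99, (1.3)–(1.5) p.77, Thm 8 (1.146) p.101; Balaban1985BackgroundPropagators, (3.35) p.396, (3.69) p.404, Thm 3.1 p.397, Thm 3.3 p.399; Balaban1989LargeFieldII, Thm 1 + (0.1) pp.355–356 (bookkeeping)]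
-/

noncomputable section

namespace Summit.QuantumFields.YangMills.BalabanUVNodes.N05AtXPinnedP2DSViewSepCoPHOfThm33JunctionHAtZdFrame


open Literature.MathematicalPhysics.QuantumFieldTheory.Balaban1983to89
open Literature.MathematicalPhysics.QuantumFieldTheory.Balaban1983to89.Node00
open Literature.MathematicalPhysics.QuantumFieldTheory.Balaban1983to89.B8IdxB8LawsB (IdxB8LawsB)
open Literature.MathematicalPhysics.QuantumFieldTheory.Balaban1983to89.B8LeafModelZd (ZdIdx)
open Literature.MathematicalPhysics.QuantumFieldTheory.Balaban1983to89.B8TowerBondsPrinted (towerBondsP)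
open Literature.MathematicalPhysics.QuantumFieldTheory.Balaban1983to89.B8SockLettersRD (SockLettersRD)
open Literature.MathematicalPhysics.QuantumFieldTheory.Balaban1983to89.B8Eq138LandauZd (covLap QT)
open B7Prop1Explicit B7Prop2Explicit B7Prop1Local
open B8Ineq132 (InAk covDerivFwd)
open B7Eq78Linearization (zdBlocking QprimeIter)
open B8Eq119TwistedAxial (bgT)
open B8Eq140Level (SideTouches)
open B8Eq1117Concrete (XSpace)
open B8Prop5ContractionKLevel (Bd2)
open B8LambdaSpaceKLevel (wt)

open B9SupplySockB9P3ZdLetters (OpsZd DictGlob)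
open B9SupplySockB9P3ZdAt (DictAt LandauAt SrcAt dictAt_of_global)
open B9SupplySockB9P3ZdAtLin (LinBddAt)
open B9SupplySockB9P3ZdGammaUnivDelta2 (HolderAtδ2)
open B9SupplySockB9P3ZdAtHerm (InvAtH)
open B9SupplySockB9P3ZdGammaUnivDelta2Src (SrcHolderAtδ2)
open B9SupplySockB9P3ZdFrame (MemberZd memZd bgZd ιCfgZd geoZd ιLocZd)
open B9SupplySockB9P3ZdLocalLettersOfOps (GAZdFamOfOps GAZdFamOfOps_eq)
open B9SupplySockB9P3ZdInstance (dictGlob_zd)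
open B9SupplySockB9P3ZdGammaInAkDpZd (withDpZd withDpZd_Dp curvAtInAk_of_Dp_eq)
open B9Eq369CurvSmallZd (DpZd)
open B9Eq316AveragingTransposeZdPrinted (withQQP withQQP_Dp)
open Summit.QuantumFields.YangMills.BalabanUVNodes.N05SubBP2DSlotExistsOfThm33JunctionHWithQQPP6
  (exists_residB8_b8LeafOfRecordSubBP₂D_cutSubBP₅_of_letters_thm33_junctionH_withQQP_P6)

-- `Site` alone could resolve to the torus sites of `Setup.lean`; re-export the `ℤ^d` sites of `B7Prop1Explicit`.
export B7Prop1Explicit (Site)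
open Literature.MathematicalPhysics.QuantumFieldTheory.Balaban1983to89.Node00
open Literature.MathematicalPhysics.QuantumFieldTheory.Balaban1983to89.T4Continuum
open Literature.MathematicalPhysics.QuantumFieldTheory.Balaban1983to89.DagBinding
open Summit.QuantumFields.YangMills.BalabanUVNodes.N05SubBP2DSlotExistsOfThm33JunctionHAtZdFrame (exists_residB8_b8LeafOfRecordSubBP₂D_cutSubBP₅_of_letters_thm33_junctionH_zdFrameI
  exists_residB8_b8LeafOfRecordSubBP₂D_cutSubBP₅_of_letters_thm33_junctionH_zdFrame)
open Summit.QuantumFields.YangMills.BalabanUVNodes.N05AtXPinnedP2DSViewSepCoPH (exists_isRecordOfRecord₁₃CSepCoPHSX3P₂DV_b8_of_leaf)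
open scoped Matrix.Norms.L2Operator

/-! ## N05 in ∃-currency at the engine's four-pin X-P₂D view (dag-n05-d g14's edition ∘ this seat's X-view slot closer), for ANY `lam12 lam13 Mstar ops13 ζ lamW` -/

section AtXView

variable {F : T4Family} {N : ℕ} [NeZero N]

/-- ★ **N05 AT THE ENGINE'S FOUR-PIN X-P₂D v1.7 RECORD OF EVERY ADMISSIBLE PARAMETER — FROM [4] THM 3.1's LETTERS, N06's THEOREM 3.3 AT ITS FULL `ℤᵈ` FRAME OF RECORD (`geoZd ∕ bgZd ∕ GAZdFamOfOps ∕ ιLocZd`, letters `withQQP ∘ withDpZd`) AND SIX JUNCTION BINDERS — `havg`, `hP6`, `hdict`, `hcurv` DISCHARGED** (image of dag-n05-d g14's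
`exists_residB8_b8LeafOfRecordSubBP₂D_cutSubBP₅_of_letters_thm33_junctionH_zdFrame` at the X-view record, ANY `lam12 lam13 Mstar ops13 ζ lamW`; curried shape kept).  Hypotheses: [4] Thm 3.1's letters `SLet ∕ SLetUB`, N06's `B9.Thm33Printed` at its `ℤᵈ` frame (N06's node sentence (γ), unproved here) and the six remaining junction binders are HYPOTHESES (N06 content, m ≥ 1 OPEN; satisfiability class-wise NOT claimed); Prop 6, the dictionary and (3.69) are THEOREMS inside; N05 NOT discharged.
[cite: Balaban1985RegularSpaces, Lemma 1 – Thm 8 pp.79–101, Prop. 6 p.99, (1.3)–(1.5) p.77, Thm 8 (1.146) p.101; Balaban1985BackgroundPropagators, (3.35) p.396, (3.69) p.404, Thm 3.1 p.397, Thm 3.3 p.399; Balaban1989LargeFieldII, Thm 1 + (0.1) pp.355–356 (bookkeeping)] -/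
theorem exists_isRecordOfRecord₁₃CSepCoPHSX3P₂DV_b8_of_letters_thm33_junctionH_zdFrame (θ : Stage13HParams F N) (h : θ.Provisos₁₃SepCoPH F N) (hθ : θ.Admissible F N)
    (lam12 : ResidB12 F N θ.τ9.M) (lam13 : B12.RunParams → ResidB13 θ.toStage3Params) (Mstar : ℕ) (ops13 : OpsY N θ.toStage3Params Mstar)
    (ζ : ResidZ F N) (lamW : ResidW F N)
    (hL5 : 5 ≤ θ.toStage3Params.L) {γw : ℝ} (hγ0 : 0 < γw) (hγ1 : γw ≤ θ.γ) [FiniteDimensional ℝ θ.toStage3Params.𝔸] :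
    ∃ c35₀ M₆ : ℝ, 0 < c35₀ ∧ 0 < M₆ ∧
      ∀ ⦃c35 : ℝ⦄, c35₀ ≤ c35 → ∀ ⦃M₃ : ℝ⦄, M₆ ≤ M₃ →
      -- [Balaban1985BackgroundPropagators] Thm 3.1's letter bounds and threshold
      ∀ {B₀'H B₂' BG BR cL : ℝ}, 0 < B₀'H → 0 ≤ B₂' → 0 ≤ BG → 0 ≤ BR → 0 < cL →
      -- [4]'s letters AT THE (1.3)–(1.5)-ADMISSIBLE `Ω₀ = ℤᵈ` LAW MEMBERS (p619291's texts verbatim): existence side and uniqueness side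
      (∀ i : ZdIdx θ.toStage3Params.D θ.toStage3Params.L, i.Ω 0 = Set.univ → IdxB8LawsB θ.toStage3Params.L i → B8ConstraintBonds.DomainSeq θ.toStage3Params.L i.Ω → (∀ l, l < i.k → ∀ z ∈ i.Λs i.k l, ((θ.toStage3Params.L : ℤ) ^ l) • z ∈ B8ConstraintBonds.Lam θ.toStage3Params.L i.Ω l) → SockLettersRD (𝔸 := θ.toStage3Params.𝔸) θ.toStage3Params.L BG BR B₀'H B₂' cL i.η i.k i.Ω i.Λs) →
      (∀ i : ZdIdx θ.toStage3Params.D θ.toStage3Params.L, i.Ω 0 = Set.univ → IdxB8LawsB θ.toStage3Params.L i → B8ConstraintBonds.DomainSeq θ.toStage3Params.L i.Ω → (∀ l, l < i.k → ∀ z ∈ i.Λs i.k l, ((θ.toStage3Params.L : ℤ) ^ l) • z ∈ B8ConstraintBonds.Lam θ.toStage3Params.L i.Ω l) → ∀ α₀ : ℝ, 0 < α₀ → α₀ ≤ cL → ∀ U₀ : Site θ.toStage3Params.D → Fin θ.toStage3Params.D → θ.toStage3Params.𝔸ˣ, (∀ x κ, U₀ x κ ∈ unitaryUnits θ.toStage3Params.𝔸)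 →
        InAk θ.toStage3Params.L i.k i.η α₀ i.Ω U₀ →
        ∃ (g Δ : (Site θ.toStage3Params.D → θ.toStage3Params.𝔸) →ₗ[ℂ] (Site θ.toStage3Params.D → θ.toStage3Params.𝔸)) (q : (Site θ.toStage3Params.D → θ.toStage3Params.𝔸) →ₗ[ℂ] (ℕ → Site θ.toStage3Params.D → θ.toStage3Params.𝔸))
          (qs : (ℕ → Site θ.toStage3Params.D → θ.toStage3Params.𝔸) →ₗ[ℂ] (Site θ.toStage3Params.D → θ.toStage3Params.𝔸)) (Aw c : (ℕ → Site θ.toStage3Params.D → θ.toStage3Params.𝔸) →ₗ[ℂ] (ℕ → Site θ.toStage3Params.D → θ.toStage3Params.𝔸))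
          (H' : XSpace θ.toStage3Params.D i.k θ.toStage3Params.𝔸 →ₗ[ℂ] (Site θ.toStage3Params.D → θ.toStage3Params.𝔸)),
          (∀ x : Site θ.toStage3Params.D → θ.toStage3Params.𝔸, (∃ C : ℝ, ∀ y, ‖x y‖ ≤ C) → g (Δ x + qs (Aw (q x))) = x) ∧ (∀ φ, qs (c (q (g (g (qs φ))))) = qs φ) ∧
          (∀ (f : Site θ.toStage3Params.D → θ.toStage3Params.𝔸), ∀ x ∈ i.Ω 0, Δ f x = covLap i.η U₀ ((i.Ω 0).indicator f) x) ∧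
          (∀ (μ : ℕ → Site θ.toStage3Params.D → θ.toStage3Params.𝔸), ∀ x ∈ i.Ω 0, qs μ x = QT θ.toStage3Params.L i.k (i.Λs i.k) U₀ μ x) ∧
          (∀ (f : Site θ.toStage3Params.D → θ.toStage3Params.𝔸) (n : ℕ), n ≤ i.k → ∀ y ∈ i.Λs i.k n, q f n y = QprimeIter (zdBlocking θ.toStage3Params.D θ.toStage3Params.L) (bgT θ.toStage3Params.L U₀) n f y) ∧
          (∀ (f : Site θ.toStage3Params.D → θ.toStage3Params.𝔸) (n : ℕ) (y : Site θ.toStage3Params.D), ¬ (n ≤ i.k ∧ y ∈ i.Λs i.k n) → q f n y = 0) ∧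
          (∀ (X : XSpace θ.toStage3Params.D i.k θ.toStage3Params.𝔸) (x : Site θ.toStage3Params.D), ‖H' X x‖ ≤ B₀'H * ‖X‖) ∧
          (∀ n, n ≤ i.k → ∀ (X : XSpace θ.toStage3Params.D i.k θ.toStage3Params.𝔸), ∀ p ∈ {b : Site θ.toStage3Params.D × Fin θ.toStage3Params.D | SideTouches (i.Ω n) b.1 b.2},
            wt θ.toStage3Params.L i.η n * ‖covDerivFwd i.η U₀ p.2 (H' X) p.1‖ ≤ B₀'H * ‖X‖) ∧
          (∀ X : XSpace θ.toStage3Params.D i.k θ.toStage3Params.𝔸, Bd2 θ.toStage3Params.L i.η i.k i.Ω (covLap i.η U₀ (H' X)) (B₂' * ‖X‖)) ∧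
          (∀ (Y : XSpace θ.toStage3Params.D i.k θ.toStage3Params.𝔸) (n : ℕ) (hn : n ≤ i.k) (y : Site θ.toStage3Params.D), y ∈ i.Λs i.k n →
            QprimeIter (zdBlocking θ.toStage3Params.D θ.toStage3Params.L) (bgT θ.toStage3Params.L U₀) n (H' Y) y = Y (⟨n, Nat.lt_succ_of_le hn⟩, y)) ∧
          (∀ (f : Site θ.toStage3Params.D → θ.toStage3Params.𝔸) (r : ℝ), 0 ≤ r → Bd2 θ.toStage3Params.L i.η i.k i.Ω f r →
            (∀ x, ‖g f x‖ ≤ BG * r) ∧ ∀ n, n ≤ i.k → ∀ p ∈ {b : Site θ.toStage3Params.D × Fin θ.toStage3Params.D | SideTouches (i.Ω n) b.1 b.2},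
              wt θ.toStage3Params.L i.η n * ‖covDerivFwd i.η U₀ p.2 (g f) p.1‖ ≤ BG * r) ∧
          (∀ (f : Site θ.toStage3Params.D → θ.toStage3Params.𝔸) (r : ℝ), 0 ≤ r → Bd2 θ.toStage3Params.L i.η i.k i.Ω f r → Bd2 θ.toStage3Params.L i.η i.k i.Ω (f - g (qs (c (q (g f))))) (BR * r))) →
      -- N06's `ℤᵈ` FRAME OF RECORD (dag-n06-e): lengths `len`, geometries `geoZd`, backgrounds `bgZd`, the kernel family `GAZdFamOfOps … ops` READ OFF the letters `ops`
      -- (dag-n06-e's `B9SupplySockB9P3ZdLocalLettersOfOps`), locality map `ιLocZd`; the (3.8)-side family `Gp` of Theorems 3.1–3.2 stays free (read by `Thm33Printed` only)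
      ∀ (len : Site θ.toStage3Params.D → ℝ) (Gp : ∀ x, B9.KernelFamily (geoZd θ.toStage3Params.𝔸 θ.toStage3Params.L len x) (bgZd θ.toStage3Params.𝔸 θ.toStage3Params.L x))
        (ops : ℝ → ZdIdx θ.toStage3Params.D θ.toStage3Params.L → ℕ → OpsZd θ.toStage3Params.D θ.toStage3Params.𝔸)
      -- THE GENUINE AVERAGING LETTER `Q*aQ` (EDITION P, dag-n06-b) AND THE GENUINE CURVATURE LETTER `Δ′(U₀)` (dag-n06-w2's `withDpZd`), pinned pointwise
        (τ : θ.toStage3Params.𝔸 →ₗ[ℂ] ℂ) {Cτ : ℝ}, (∀ x y : θ.toStage3Params.𝔸, |(τ (star x * y)).re| ≤ Cτ * ‖x‖ * ‖y‖) →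
      ∀ (ops₀ : ℝ → ZdIdx θ.toStage3Params.D θ.toStage3Params.L → ℕ → OpsZd θ.toStage3Params.D θ.toStage3Params.𝔸),
        (∀ (M : ℝ) (i : ZdIdx θ.toStage3Params.D θ.toStage3Params.L) (m : ℕ), ops M i m = withQQP τ θ.toStage3Params.L (fun m' l => towerBondsP θ.toStage3Params.L i.Ω (i.Λs m') l) (withDpZd ops₀) M i m) →
      ∀ {a₃ β cS cSβ : ℝ} {CH : ℝ → ℝ},
      -- N06's THEOREM 3.3 AS PRINTED — ITS NODE SENTENCE (γ) AT THE `ℤᵈ` FRAME OF RECORD, VERBATIM (the kernel family of `G(U₀)` read off `ops`)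
        B9.Thm33Printed c35 (geoZd θ.toStage3Params.𝔸 θ.toStage3Params.L len) (bgZd θ.toStage3Params.𝔸 θ.toStage3Params.L) Gp (GAZdFamOfOps θ.toStage3Params.𝔸 θ.toStage3Params.L len ops) →
      -- dag-n06-b's JUNCTION BINDERS at the (1.3)–(1.5)-admissible members, guarded — SIX of them: NO `havg` (dag-n05-d g13 C), NO `hP6` (dag-n05-e), NO `hdict`, NO `hcurv` (this file)
        (∀ (M : ℝ) (j : IdxB8SubD θ.toStage3Params) (m : ℕ), 1 ≤ M → M₃ ≤ M → m ≤ j.1.1.1.1.k → InvAtH (bgZd θ.toStage3Params.𝔸 θ.toStage3Params.L) θ.toStage3Params.L memZd (ιCfgZd θ.toStage3Params.𝔸 θ.toStage3Params.L) ops c35 a₃ M j.1.1.1.1 m) →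
        (∀ (M : ℝ) (j : IdxB8SubD θ.toStage3Params) (m : ℕ), 1 ≤ M → M₃ ≤ M → m ≤ j.1.1.1.1.k → LandauAt (bgZd θ.toStage3Params.𝔸 θ.toStage3Params.L) θ.toStage3Params.L memZd (ιCfgZd θ.toStage3Params.𝔸 θ.toStage3Params.L) ops c35 a₃ M j.1.1.1.1 m) →
        (∀ (M : ℝ) (j : IdxB8SubD θ.toStage3Params) (m : ℕ), 1 ≤ M → M₃ ≤ M → m ≤ j.1.1.1.1.k → HolderAtδ2 (geoZd θ.toStage3Params.𝔸 θ.toStage3Params.L len) (bgZd θ.toStage3Params.𝔸 θ.toStage3Params.L) (GAZdFamOfOps θ.toStage3Params.𝔸 θ.toStage3Params.L len ops) θ.toStage3Params.L memZd (ιCfgZd θ.toStage3Params.𝔸 θ.toStage3Params.L) ops β len CH M j.1.1.1.1 m) →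
        (∀ (M : ℝ) (j : IdxB8SubD θ.toStage3Params) (m : ℕ), 1 ≤ M → M₃ ≤ M → m ≤ j.1.1.1.1.k → LinBddAt θ.toStage3Params.L ops M j.1.1.1.1 m) →
        (∀ (M : ℝ) (j : IdxB8SubD θ.toStage3Params) (m : ℕ), 1 ≤ M → M₃ ≤ M → m ≤ j.1.1.1.1.k → SrcAt (bgZd θ.toStage3Params.𝔸 θ.toStage3Params.L) θ.toStage3Params.L memZd (ιCfgZd θ.toStage3Params.𝔸 θ.toStage3Params.L) ops c35 a₃ cS M j.1.1.1.1 m) →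
        (∀ (M : ℝ) (j : IdxB8SubD θ.toStage3Params) (m : ℕ), 1 ≤ M → M₃ ≤ M → m ≤ j.1.1.1.1.k → SrcHolderAtδ2 (bgZd θ.toStage3Params.𝔸 θ.toStage3Params.L) θ.toStage3Params.L memZd (ιCfgZd θ.toStage3Params.𝔸 θ.toStage3Params.L) ops c35 a₃ β len cSβ M j.1.1.1.1 m) →
      -- the junction's primitive constants ((3.27) `a₃`, source `c_S c_Sβ`; (3.69)'s `c69` is now `14(D−1)`, dag-n06-w2) and Theorem 8's source size factor `γ₈`
        0 < a₃ → 0 ≤ cS → 0 ≤ cSβ → ∀ {γ₈ : ℝ}, 1 ≤ γ₈ →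
        ∃ (lam : ResidB8 θ.toStage3Params) (c₁ : ℝ) (ρ₀ : ℕ) (w w' : WorldP), IsRecordOfRecord₁₃CSepCoPHSX3P₂DV F N (datumOfRecord₁₃SepCoPH F N θ h) w ∧
          w.C = (datumOfRecord₁₃SepCoPH F N θ h).C ∧ w.γ = γw ∧ w.L = (θ.L : ℝ) ∧
          (∀ P : B12.RunParams, w.up P =
            upOfRecord₅CSC F N ((θ.pinX3P₂D F N (lam.cutSubBP₅ c₁ ρ₀) lam12 lam13).view₁₃CoPHB10YZW F N Mstar ops13 ζ lamW) (c₇OfRecord θ.toStage3Params) P) ∧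
          (∀ P : B12.RunParams, (leavesP w P).b8 ∧ Dag.B8_main (leavesP w P)) ∧
          IsRecordOfRecord₁₃CSepCoPH F N (datumOfRecord₁₃SepCoPH F N θ h) w' ∧ w'.C = w.C ∧ w'.γ = w.γ ∧ w'.L = w.L ∧
          ∀ P : B12.RunParams, leavesP w P = { leavesP w' P with b8 := (leavesP w P).b8 } := by
  obtain ⟨c35₀, M₆, hc35₀, hM₆, H⟩ := exists_residB8_b8LeafOfRecordSubBP₂D_cutSubBP₅_of_letters_thm33_junctionH_zdFrame θ.toStage3Params (hθ.toStage9.toStage8).1.1.1.1 hL5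
  refine ⟨c35₀, M₆, hc35₀, hM₆, ?_⟩
  intro c35 hc35 M₃ hM₃ B₀'H B₂' BG BR cL hB₀'H hB₂' hBG hBR hcL SLet SLetUB len Gp ops τ Cτ hCτ ops₀ hops a₃ β cS cSβ CH h33 hinv hlan hhol hlin hsrc hsrcH ha₃ hcS hcSβ γ₈ hγ₈
  obtain ⟨lam, c₁, ρ₀, hslot⟩ := H hc35 hM₃ hB₀'H hB₂' hBG hBR hcL SLet SLetUB len Gp ops τ hCτ ops₀ hops h33 hinv hlan hhol hlin hsrc hsrcH ha₃ hcS hcSβ hγ₈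
  exact ⟨lam, c₁, ρ₀, exists_isRecordOfRecord₁₃CSepCoPHSX3P₂DV_b8_of_leaf θ h hθ lam12 lam13 Mstar ops13 ζ lamW (lam.cutSubBP₅ c₁ ρ₀) hslot hγ0 hγ1⟩

end AtXView

/-! ## (§3 ∕ §4 — same filing as §1–§2). the INDEX-GENERIC edition `_zdFrameI` (dag-n05-d g14 v1.1 p636957 §2: any index `I`, `π : I → MemberZd`, `mem` with `hmem` at the admissible members, frame of record read through `π`, N06's sentence `B9.Thm33Printed c35 (geoZd … ∘ π) (bgZd … ∘ π) Gp (GAZdFamOfOps … ops ∘ π)` over `I`; six binders) — read at the engine's four-pin X-P₂D view -/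

section Appendoflettersthm33junctionHzdFrameIX

variable {F : T4Family} {N : ℕ} [NeZero N]

/-- ★ **N05 AT THE ENGINE'S FOUR-PIN X-P₂D RECORD — image of `exists_residB8_b8LeafOfRecordSubBP₂D_cutSubBP₅_of_letters_thm33_junctionH_zdFrameI`** (the INDEX-GENERIC edition `_zdFrameI` (dag-n05-d g14 v1.1 p636957 §2: any index `I`, `π : I → MemberZd`, `mem` with `hmem` at the admissible members, frame of record read through `π`, N06's sentence `B9.Thm33Printed c35 (geoZd … ∘ π) (bgZd … ∘ π) Gp (GAZdFamOfOps … ops ∘ π)` over `I`; six binders); ANY `lam12 lam13 Mstar ops13 ζ lamW`; curried shape kept;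
this seat's X-view closer p622349).  Hypotheses: [4] Thm 3.1's letters, N06's `B9.Thm33Printed` over `I` at the `ℤᵈ` frame read through `π` and the six remaining junction binders are HYPOTHESES (N06 content, m ≥ 1 OPEN; sound sub-indices are the consumer's choice, n06-b LOCATED-SELF-7); N05 NOT discharged.
[cite: Balaban1985RegularSpaces, Lemma 1 – Thm 8 pp.79–101, Prop. 6 p.99, (1.3)–(1.5) p.77, Thm 8 (1.146) p.101; Balaban1985BackgroundPropagators, (3.35) p.396, (3.69) p.404, Thm 3.1 p.397, Thm 3.3 p.399; Balaban1989LargeFieldII, Thm 1 + (0.1) pp.355–356 (bookkeeping)] -/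
theorem exists_isRecordOfRecord₁₃CSepCoPHSX3P₂DV_b8_of_letters_thm33_junctionH_zdFrameI (θ : Stage13HParams F N) (h : θ.Provisos₁₃SepCoPH F N) (hθ : θ.Admissible F N)
    (lam12 : ResidB12 F N θ.τ9.M) (lam13 : B12.RunParams → ResidB13 θ.toStage3Params) (Mstar : ℕ) (ops13 : OpsY N θ.toStage3Params Mstar)
    (ζ : ResidZ F N) (lamW : ResidW F N)
    (hL5 : 5 ≤ θ.toStage3Params.L) {γw : ℝ} (hγ0 : 0 < γw) (hγ1 : γw ≤ θ.γ) [FiniteDimensional ℝ θ.toStage3Params.𝔸] :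
    ∃ c35₀ M₆ : ℝ, 0 < c35₀ ∧ 0 < M₆ ∧
      ∀ ⦃c35 : ℝ⦄, c35₀ ≤ c35 → ∀ ⦃M₃ : ℝ⦄, M₆ ≤ M₃ →
      -- [Balaban1985BackgroundPropagators] Thm 3.1's letter bounds and threshold
      ∀ {B₀'H B₂' BG BR cL : ℝ}, 0 < B₀'H → 0 ≤ B₂' → 0 ≤ BG → 0 ≤ BR → 0 < cL →
      -- [4]'s letters AT THE (1.3)–(1.5)-ADMISSIBLE `Ω₀ = ℤᵈ` LAW MEMBERS (p619291's texts verbatim): existence side and uniqueness side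
      (∀ i : ZdIdx θ.toStage3Params.D θ.toStage3Params.L, i.Ω 0 = Set.univ → IdxB8LawsB θ.toStage3Params.L i → B8ConstraintBonds.DomainSeq θ.toStage3Params.L i.Ω → (∀ l, l < i.k → ∀ z ∈ i.Λs i.k l, ((θ.toStage3Params.L : ℤ) ^ l) • z ∈ B8ConstraintBonds.Lam θ.toStage3Params.L i.Ω l) → SockLettersRD (𝔸 := θ.toStage3Params.𝔸) θ.toStage3Params.L BG BR B₀'H B₂' cL i.η i.k i.Ω i.Λs) →
      (∀ i : ZdIdx θ.toStage3Params.D θ.toStage3Params.L, i.Ω 0 = Set.univ → IdxB8LawsB θ.toStage3Params.L i → B8ConstraintBonds.DomainSeq θ.toStage3Params.L i.Ω → (∀ l, l < i.k → ∀ z ∈ i.Λs i.k l, ((θ.toStage3Params.L : ℤ) ^ l) • z ∈ B8ConstraintBonds.Lam θ.toStage3Params.L i.Ω l) → ∀ α₀ : ℝ, 0 < α₀ → α₀ ≤ cL → ∀ U₀ : Site θ.toStage3Params.D → Fin θ.toStage3Params.D → θ.toStage3Params.𝔸ˣ, (∀ x κ, U₀ x κ ∈ unitaryUnits θ.toStage3Params.𝔸)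 →
        InAk θ.toStage3Params.L i.k i.η α₀ i.Ω U₀ →
        ∃ (g Δ : (Site θ.toStage3Params.D → θ.toStage3Params.𝔸) →ₗ[ℂ] (Site θ.toStage3Params.D → θ.toStage3Params.𝔸)) (q : (Site θ.toStage3Params.D → θ.toStage3Params.𝔸) →ₗ[ℂ] (ℕ → Site θ.toStage3Params.D → θ.toStage3Params.𝔸))
          (qs : (ℕ → Site θ.toStage3Params.D → θ.toStage3Params.𝔸) →ₗ[ℂ] (Site θ.toStage3Params.D → θ.toStage3Params.𝔸)) (Aw c : (ℕ → Site θ.toStage3Params.D → θ.toStage3Params.𝔸) →ₗ[ℂ] (ℕ → Site θ.toStage3Params.D → θ.toStage3Params.𝔸))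
          (H' : XSpace θ.toStage3Params.D i.k θ.toStage3Params.𝔸 →ₗ[ℂ] (Site θ.toStage3Params.D → θ.toStage3Params.𝔸)),
          (∀ x : Site θ.toStage3Params.D → θ.toStage3Params.𝔸, (∃ C : ℝ, ∀ y, ‖x y‖ ≤ C) → g (Δ x + qs (Aw (q x))) = x) ∧ (∀ φ, qs (c (q (g (g (qs φ))))) = qs φ) ∧
          (∀ (f : Site θ.toStage3Params.D → θ.toStage3Params.𝔸), ∀ x ∈ i.Ω 0, Δ f x = covLap i.η U₀ ((i.Ω 0).indicator f) x) ∧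
          (∀ (μ : ℕ → Site θ.toStage3Params.D → θ.toStage3Params.𝔸), ∀ x ∈ i.Ω 0, qs μ x = QT θ.toStage3Params.L i.k (i.Λs i.k) U₀ μ x) ∧
          (∀ (f : Site θ.toStage3Params.D → θ.toStage3Params.𝔸) (n : ℕ), n ≤ i.k → ∀ y ∈ i.Λs i.k n, q f n y = QprimeIter (zdBlocking θ.toStage3Params.D θ.toStage3Params.L) (bgT θ.toStage3Params.L U₀) n f y) ∧
          (∀ (f : Site θ.toStage3Params.D → θ.toStage3Params.𝔸) (n : ℕ) (y : Site θ.toStage3Params.D), ¬ (n ≤ i.k ∧ y ∈ i.Λs i.k n) → q f n y = 0) ∧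
          (∀ (X : XSpace θ.toStage3Params.D i.k θ.toStage3Params.𝔸) (x : Site θ.toStage3Params.D), ‖H' X x‖ ≤ B₀'H * ‖X‖) ∧
          (∀ n, n ≤ i.k → ∀ (X : XSpace θ.toStage3Params.D i.k θ.toStage3Params.𝔸), ∀ p ∈ {b : Site θ.toStage3Params.D × Fin θ.toStage3Params.D | SideTouches (i.Ω n) b.1 b.2},
            wt θ.toStage3Params.L i.η n * ‖covDerivFwd i.η U₀ p.2 (H' X) p.1‖ ≤ B₀'H * ‖X‖) ∧
          (∀ X : XSpace θ.toStage3Params.D i.k θ.toStage3Params.𝔸, Bd2 θ.toStage3Params.L i.η i.k i.Ω (covLap i.η U₀ (H' X)) (B₂' * ‖X‖)) ∧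
          (∀ (Y : XSpace θ.toStage3Params.D i.k θ.toStage3Params.𝔸) (n : ℕ) (hn : n ≤ i.k) (y : Site θ.toStage3Params.D), y ∈ i.Λs i.k n →
            QprimeIter (zdBlocking θ.toStage3Params.D θ.toStage3Params.L) (bgT θ.toStage3Params.L U₀) n (H' Y) y = Y (⟨n, Nat.lt_succ_of_le hn⟩, y)) ∧
          (∀ (f : Site θ.toStage3Params.D → θ.toStage3Params.𝔸) (r : ℝ), 0 ≤ r → Bd2 θ.toStage3Params.L i.η i.k i.Ω f r →
            (∀ x, ‖g f x‖ ≤ BG * r) ∧ ∀ n, n ≤ i.k → ∀ p ∈ {b : Site θ.toStage3Params.D × Fin θ.toStage3Params.D | SideTouches (i.Ω n) b.1 b.2},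
              wt θ.toStage3Params.L i.η n * ‖covDerivFwd i.η U₀ p.2 (g f) p.1‖ ≤ BG * r) ∧
          (∀ (f : Site θ.toStage3Params.D → θ.toStage3Params.𝔸) (r : ℝ), 0 ≤ r → Bd2 θ.toStage3Params.L i.η i.k i.Ω f r → Bd2 θ.toStage3Params.L i.η i.k i.Ω (f - g (qs (c (q (g f))))) (BR * r))) →
      -- ANY INDEX re-indexed into the `ℤᵈ` members of record by `π`, a member map landing on `memZd` at the admissible members, and N06's `ℤᵈ` FRAME OF RECORD
      -- READ THROUGH `π` (dag-n06-e): lengths `len`, geometries `geoZd ∘ π`, backgrounds `bgZd ∘ π`, the kernel family `GAZdFamOfOps … ops ∘ π` READ OFF the letters `ops`,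
      -- locality map the identity; the (3.8)-side family `Gp` of Theorems 3.1–3.2 stays free (read by `Thm33Printed` only)
      ∀ {I : Type} (π : I → MemberZd θ.toStage3Params.D θ.toStage3Params.L) (len : Site θ.toStage3Params.D → ℝ) (Gp : ∀ i, B9.KernelFamily (geoZd θ.toStage3Params.𝔸 θ.toStage3Params.L len (π i)) (bgZd θ.toStage3Params.𝔸 θ.toStage3Params.L (π i)))
        (mem : ℝ → ZdIdx θ.toStage3Params.D θ.toStage3Params.L → ℕ → I),
        (∀ (M : ℝ) (j : IdxB8SubD θ.toStage3Params) (m : ℕ), π (mem M j.1.1.1.1 m) = memZd M j.1.1.1.1 m) →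
      ∀ (ops : ℝ → ZdIdx θ.toStage3Params.D θ.toStage3Params.L → ℕ → OpsZd θ.toStage3Params.D θ.toStage3Params.𝔸)
      -- THE GENUINE AVERAGING LETTER `Q*aQ` (EDITION P, dag-n06-b) AND THE GENUINE CURVATURE LETTER `Δ′(U₀)` (dag-n06-w2's `withDpZd`), pinned pointwise
        (τ : θ.toStage3Params.𝔸 →ₗ[ℂ] ℂ) {Cτ : ℝ}, (∀ x y : θ.toStage3Params.𝔸, |(τ (star x * y)).re| ≤ Cτ * ‖x‖ * ‖y‖) →
      ∀ (ops₀ : ℝ → ZdIdx θ.toStage3Params.D θ.toStage3Params.L → ℕ → OpsZd θ.toStage3Params.D θ.toStage3Params.𝔸),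
        (∀ (M : ℝ) (i : ZdIdx θ.toStage3Params.D θ.toStage3Params.L) (m : ℕ), ops M i m = withQQP τ θ.toStage3Params.L (fun m' l => towerBondsP θ.toStage3Params.L i.Ω (i.Λs m') l) (withDpZd ops₀) M i m) →
      ∀ {a₃ β cS cSβ : ℝ} {CH : ℝ → ℝ},
      -- N06's THEOREM 3.3 AS PRINTED — ITS NODE SENTENCE (γ) AT THE `ℤᵈ` FRAME OF RECORD READ THROUGH `π` (over `I`: sound sub-indices are the consumer's choice)
        B9.Thm33Printed c35 (fun i => geoZd θ.toStage3Params.𝔸 θ.toStage3Params.L len (π i)) (fun i => bgZd θ.toStage3Params.𝔸 θ.toStage3Params.L (π i)) Gp (fun i => GAZdFamOfOps θ.toStage3Params.𝔸 θ.toStage3Params.L len ops (π i)) →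
      -- dag-n06-b's JUNCTION BINDERS at the (1.3)–(1.5)-admissible members, guarded — SIX of them: NO `havg` (dag-n05-d g13 C), NO `hP6` (dag-n05-e), NO `hdict`, NO `hcurv` (this file)
        (∀ (M : ℝ) (j : IdxB8SubD θ.toStage3Params) (m : ℕ), 1 ≤ M → M₃ ≤ M → m ≤ j.1.1.1.1.k → InvAtH (fun i => bgZd θ.toStage3Params.𝔸 θ.toStage3Params.L (π i)) θ.toStage3Params.L mem (fun M i m U₀ hU₀ => ιCfgZd θ.toStage3Params.𝔸 θ.toStage3Params.L M i m U₀ hU₀) ops c35 a₃ M j.1.1.1.1 m) →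
        (∀ (M : ℝ) (j : IdxB8SubD θ.toStage3Params) (m : ℕ), 1 ≤ M → M₃ ≤ M → m ≤ j.1.1.1.1.k → LandauAt (fun i => bgZd θ.toStage3Params.𝔸 θ.toStage3Params.L (π i)) θ.toStage3Params.L mem (fun M i m U₀ hU₀ => ιCfgZd θ.toStage3Params.𝔸 θ.toStage3Params.L M i m U₀ hU₀) ops c35 a₃ M j.1.1.1.1 m) →
        (∀ (M : ℝ) (j : IdxB8SubD θ.toStage3Params) (m : ℕ), 1 ≤ M → M₃ ≤ M → m ≤ j.1.1.1.1.k → HolderAtδ2 (fun i => geoZd θ.toStage3Params.𝔸 θ.toStage3Params.L len (π i)) (fun i => bgZd θ.toStage3Params.𝔸 θ.toStage3Params.L (π i)) (fun i => GAZdFamOfOps θ.toStage3Params.𝔸 θ.toStage3Params.L len ops (π i)) θ.toStage3Params.L mem (fun M i m U₀ hU₀ => ιCfgZd θ.toStage3Params.𝔸 θ.toStage3Params.L M i m U₀ hU₀) ops β len CH M j.1.1.1.1 m) →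
        (∀ (M : ℝ) (j : IdxB8SubD θ.toStage3Params) (m : ℕ), 1 ≤ M → M₃ ≤ M → m ≤ j.1.1.1.1.k → LinBddAt θ.toStage3Params.L ops M j.1.1.1.1 m) →
        (∀ (M : ℝ) (j : IdxB8SubD θ.toStage3Params) (m : ℕ), 1 ≤ M → M₃ ≤ M → m ≤ j.1.1.1.1.k → SrcAt (fun i => bgZd θ.toStage3Params.𝔸 θ.toStage3Params.L (π i)) θ.toStage3Params.L mem (fun M i m U₀ hU₀ => ιCfgZd θ.toStage3Params.𝔸 θ.toStage3Params.L M i m U₀ hU₀) ops c35 a₃ cS M j.1.1.1.1 m) →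
        (∀ (M : ℝ) (j : IdxB8SubD θ.toStage3Params) (m : ℕ), 1 ≤ M → M₃ ≤ M → m ≤ j.1.1.1.1.k → SrcHolderAtδ2 (fun i => bgZd θ.toStage3Params.𝔸 θ.toStage3Params.L (π i)) θ.toStage3Params.L mem (fun M i m U₀ hU₀ => ιCfgZd θ.toStage3Params.𝔸 θ.toStage3Params.L M i m U₀ hU₀) ops c35 a₃ β len cSβ M j.1.1.1.1 m) →
      -- the junction's primitive constants ((3.27) `a₃`, source `c_S c_Sβ`; (3.69)'s `c69` is now `14(D−1)`, dag-n06-w2) and Theorem 8's source size factor `γ₈`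
        0 < a₃ → 0 ≤ cS → 0 ≤ cSβ → ∀ {γ₈ : ℝ}, 1 ≤ γ₈ →
        ∃ (lam : ResidB8 θ.toStage3Params) (c₁ : ℝ) (ρ₀ : ℕ) (w w' : WorldP), IsRecordOfRecord₁₃CSepCoPHSX3P₂DV F N (datumOfRecord₁₃SepCoPH F N θ h) w ∧
          w.C = (datumOfRecord₁₃SepCoPH F N θ h).C ∧ w.γ = γw ∧ w.L = (θ.L : ℝ) ∧
          (∀ P : B12.RunParams, w.up P =
            upOfRecord₅CSC F N ((θ.pinX3P₂D F N (lam.cutSubBP₅ c₁ ρ₀) lam12 lam13).view₁₃CoPHB10YZW F N Mstar ops13 ζ lamW) (c₇OfRecord θ.toStage3Params) P) ∧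
          (∀ P : B12.RunParams, (leavesP w P).b8 ∧ Dag.B8_main (leavesP w P)) ∧
          IsRecordOfRecord₁₃CSepCoPH F N (datumOfRecord₁₃SepCoPH F N θ h) w' ∧ w'.C = w.C ∧ w'.γ = w.γ ∧ w'.L = w.L ∧
          ∀ P : B12.RunParams, leavesP w P = { leavesP w' P with b8 := (leavesP w P).b8 } := by
  obtain ⟨c35₀, M₆, hc35₀, hM₆, H⟩ := exists_residB8_b8LeafOfRecordSubBP₂D_cutSubBP₅_of_letters_thm33_junctionH_zdFrameI θ.toStage3Params (hθ.toStage9.toStage8).1.1.1.1 hL5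
  refine ⟨c35₀, M₆, hc35₀, hM₆, ?_⟩
  intro c35 hc35 M₃ hM₃ B₀'H B₂' BG BR cL hB₀'H hB₂' hBG hBR hcL SLet SLetUB I π len Gp mem hmem ops τ Cτ hCτ ops₀ hops a₃ β cS cSβ CH h33 hinv hlan hhol hlin hsrc hsrcH ha₃ hcS hcSβ γ₈ hγ₈
  obtain ⟨lam, c₁, ρ₀, hslot⟩ := H hc35 hM₃ hB₀'H hB₂' hBG hBR hcL SLet SLetUB π len Gp mem hmem ops τ hCτ ops₀ hops h33 hinv hlan hhol hlin hsrc hsrcH ha₃ hcS hcSβ hγ₈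
  exact ⟨lam, c₁, ρ₀, exists_isRecordOfRecord₁₃CSepCoPHSX3P₂DV_b8_of_leaf θ h hθ lam12 lam13 Mstar ops13 ζ lamW (lam.cutSubBP₅ c₁ ρ₀) hslot hγ0 hγ1⟩

end Appendoflettersthm33junctionHzdFrameIX

end Summit.QuantumFields.YangMills.BalabanUVNodes.N05AtXPinnedP2DSViewSepCoPHOfThm33JunctionHAtZdFrame

end
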